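import Literature.MathematicalPhysics.QuantumFieldTheory.Balaban1983to89.B9Eq340TaxiRungs
import Literature.MathematicalPhysics.QuantumFieldTheory.Balaban1983to89.B9SectBGpLettersY
import Literature.MathematicalPhysics.QuantumFieldTheory.Balaban1983to89.Node00.OpsYRecordV4

/-!
# `Balaban1983to89.B9Eq358TaxiLettersY` — B9 p. 401–402, THE KEY ESTIMATE BEHIND (3.58) AND (3.58)∕(3.59) FOR NODE 00's TAXICAB LETTERS:
# `|(U′U)(Γ_{c,z})·(U(Γ_{c,z}))⁻¹ − 1| ≤ O(1)α₁` for the taxicab contour from the block corner `c` to a site `z` of the block, hence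
# `‖kF(s, w)‖ ≤ O(1)α₁·W_s⁻¹` and `‖sF(z)‖ ≤ O(1)α₁` (the kernel estimates ENTERING clauses 1–2 of `B9SectBGpFrameCodedY.CplxLettersY` at `par := parSymY`)

T. Bałaban, *Propagators for lattice gauge theories in a background field*, Commun. Math. Phys. **99** (1985) 389–434
[`Balaban1985BackgroundPropagators`, "B9"]; T. Bałaban, *Propagators and renormalization transformations for lattice gauge
theories. II*, Commun. Math. Phys. **96** (1984) 223–250 [`Balaban1984PropagatorsII`, "[4]"].

statement-level skeleton of published theorems with citation tags; proofs where landed; nothing here is a claim about the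
Yang–Mills mass gap

THE PRINTED LOCUS.  p. 401: *«… by the above bounds |(U′U)(Γ^{(j)}_{y,x})(U(Γ^{(j)}_{y,x}))⁻¹ − 1| < O(1)α₁.»*  p. 401 (3.57), p. 402 (3.58)–(3.59):
*«(Q′_j(U′U)λ)(y) = (Q′_j(U)λ)(y) + (F′_{2,j}(A)λ)(y), … |F′_{2,j}(A; y, x)| ≤ O(1)α₁, (3.58) hence also |(F′_{2,j}(A)λ)(y)| ≤ O(1)α₁(Q′_j|λ|)(y). (3.59)»*
Print's averaging `Q′_j` transports along the composite contours `Γ^{(j)}` of [5]; NODE 00's `Q′` (`B9Eq360DeltaPrimeAY.kQY`) is the PLAIN block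
average with the TAXICAB transporter `U(Γ_{c_s,w})` from the block corner (`Node00.OpsYTransport.parTaxiV` ∕ `parSY` ∕ `Node00.OpsYRecordV4.parSymY`),
for which the key estimate is the elementary product estimate of this file (no [5] input): along the `≤ (d+1)(Lʲ−1)` bonds of `Γ_{c_s,w}`, all
inside the block (level `j`), `|U′(b) − 1| ≤ 2α₁L^{−j}` by (3.37), and `∏(1 + 2α₁L^{−j}) − 1 ≤ 2(d+1)α₁·e^{(d+1)/2}`.

WHAT THIS FILE PROVES (0 sorry, theorems only):
* §1 the PRODUCT DEFECT along n06-i's signed step runs (`B9Eq340StepLasso.stepRun`): `norm_stepRun_prod_le` (`‖(U′U)(Γ)‖ ≤ (1+ε)^{|Γ|}`),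
  `norm_inv_stepRun_prod_le`, ★ `norm_stepRun_prod_sub_le` (`‖(U′U)(Γ) − U(Γ)‖ ≤ (1+ε)^{|Γ|} − 1`), ★ `norm_inv_stepRun_prod_sub_le`, for a
  unitary-like `U` and a multiplier `U′` with `‖U′(b) − 1‖, ‖U′(b)⁻¹ − 1‖ ≤ ε` at the traversed bonds (`rungSites`); `pow_sub_one_le` arithmetic.
* §2 `norm_Rclm_sub_le` — `‖R(p′) − R(p)‖ ≤ ‖p′ − p‖·‖p′⁻¹‖ + ‖p‖·‖p′⁻¹ − p⁻¹‖` for the `ℝ`-linear letters `Rclm`.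
* §3 GEOMETRY at NODE 00: `val_boxEquiv_symm_nat`, `two_mul_pow_lev_le_period`, `val_sub_corner_lt` (torus counts from the corner are the box
  differences `< Lʲ`), ★ `blkOf_toBox_rung_eq` (every rung site of the corner→`z` taxicab path lies in the block of `z`), `length_taxiSteps_corner_le`.
* §4 ★★ `norm_parSY_prod_sub_le` ∕ `norm_inv_parSY_prod_sub_le` — THE KEY ESTIMATE for the taxicab transporter with `O(1) = 2(d+1)e^{(d+1)/2}`;
  ★★ `norm_kFY_parSymY_le` ((3.58)), ★★ `norm_sFY_parSymY_le` ((3.59)-shape) — the estimates entering clauses 1–2 of `CplxLettersY` at `par := parSymY` (the clauses themselves, with the per-member section `hι` and the (3.37) → `ha` conversion, are assembled by the consumer `B9SectBCodedClassY.cplxLettersY_of_cplx337`).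

HONEST SCOPE.  An elementary estimate over def-Y's DEFINED letters (plain block averages, taxicab transport); the (3.37)-type input is the
pointwise bound `η‖a_μ(v)‖ ≤ α₁L^{−j}` at the bonds based in the block (clause 6 of `CplxLettersY` restricted to the block); nothing of
Thm 3.1 asserted; COUNT-NEUTRAL; N06 NOT discharged; one finite lattice programme — nothing continuum ∕ OS ∕ mass-gap ∕ Clay.  Cell `pub-ymgap`
(HUMAN RULING D-0062), Track A node N06 [B9], N06-ASSIGNMENT row 13, seat `pub-ymgap-dag-n06-c` (g8), 2026-08-27.

RELATED IN THE TREE, NOT DUPLICATED: `B9Eq340StepLasso` ∕ `B9Eq340TaxiRungs` (n06-i: signed step runs, where the rungs lie — consumed BY NAME),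
`B9Eq358KeyEstimate` ∕ `B9Eq358Decomposition` (p06: print's composite-contour averaging via [5] — a different averaging), `B6Geom246MultiLevelBox`
(`coord_bounds`, `blkOf_eq_iff_blk`), `B6GlobalChartV1` (`toBox`, `boxEquiv`), `B9Eq360DeltaPrimeAY` (`kQY ∕ sQY ∕ kFY ∕ sFY`), `Node00.OpsYRecordV4`
(`parSymY`).
-/

noncomputable section

namespace Literature.MathematicalPhysics.QuantumFieldTheory.Balaban1983to89.B9Eq358TaxiLettersY

open NormedSpace Complex
open LatticeFieldCalculus
open T4RelativeLadder (UnitaryLike)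
open B9BackgroundsKLevelV1 (CfgV1)
open B9Eq340StepLasso (stepRun stepEnd rungSites taxiSteps length_rungSites parTaxiV_eq_stepRun unitaryLike_stepRun)

/-! ## §1 The product defect along a signed step run -/

section Product

variable {P : Params} {𝔸 : Type} [NormedRing 𝔸] [NormOneClass 𝔸]

/-- **THE NORM OF A PRODUCT RUN**: if `U` is unitary-like and the multiplier satisfies `‖U′(b)‖ ≤ 1 + ε`, `‖U′(b)⁻¹‖ ≤ 1 + ε` at every traversed
bond, then `‖(U′U)(Γ)‖ ≤ (1+ε)^{|Γ|}`. [cite: Balaban1985BackgroundPropagators, (3.55) p.401 («U′U(Γ)»), (3.3) p.391] -/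
theorem norm_stepRun_prod_le {U U' : CfgV1 P 𝔸} (hU : ∀ μ x, UnitaryLike (U μ x)) {ε : ℝ} (hε : 0 ≤ ε) :
    ∀ (l : List (Fin P.d × Bool)) (w : Site P 0),
      (∀ r ∈ rungSites l w, ‖((U' r.2.1 r.1 : 𝔸ˣ) : 𝔸)‖ ≤ 1 + ε ∧ ‖(((U' r.2.1 r.1)⁻¹ : 𝔸ˣ) : 𝔸)‖ ≤ 1 + ε) →
        ‖((stepRun (fun μ x => U' μ x * U μ x) l w : 𝔸ˣ) : 𝔸)‖ ≤ (1 + ε) ^ l.length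
  | [], _, _ => by simp [stepRun]
  | (ν, true) :: l, w, h => by
    simp only [stepRun, Units.val_mul, List.length_cons, pow_succ]
    have hr := h (w, ν, true) (by simp [rungSites])
    have ih := norm_stepRun_prod_le hU hε l (w.shift ν) fun r hr' => h r (by simp [rungSites, hr'])
    calc ‖(U' ν w : 𝔸) * (U ν w : 𝔸) * (stepRun (fun μ x => U' μ x * U μ x) l (w.shift ν) : 𝔸)‖
        ≤ ‖(U' ν w : 𝔸)‖ * ‖(U ν w : 𝔸)‖ * ‖(stepRun (fun μ x => U' μ x * U μ x) l (w.shift ν) : 𝔸)‖ :=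
          (norm_mul_le _ _).trans (mul_le_mul_of_nonneg_right (norm_mul_le _ _) (norm_nonneg _))
      _ ≤ (1 + ε) * 1 * (1 + ε) ^ l.length := by
          gcongr
          · exact hr.1
          · exact (hU ν w).1
      _ = (1 + ε) ^ l.length * (1 + ε) := by ring
  | (ν, false) :: l, w, h => by
    simp only [stepRun, mul_inv_rev, Units.val_mul, List.length_cons, pow_succ]
    have hr := h (w.unshift ν, ν, false) (by simp [rungSites])
    have ih := norm_stepRun_prod_le hU hε l (w.unshift ν) fun r hr' => h r (by simp [rungSites, hr'])
    calc ‖(((U ν (w.unshift ν))⁻¹ : 𝔸ˣ) : 𝔸) * (((U' ν (w.unshift ν))⁻¹ : 𝔸ˣ) : 𝔸) *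
          (stepRun (fun μ x => U' μ x * U μ x) l (w.unshift ν) : 𝔸)‖
        ≤ ‖(((U ν (w.unshift ν))⁻¹ : 𝔸ˣ) : 𝔸)‖ * ‖(((U' ν (w.unshift ν))⁻¹ : 𝔸ˣ) : 𝔸)‖ *
            ‖(stepRun (fun μ x => U' μ x * U μ x) l (w.unshift ν) : 𝔸)‖ :=
          (norm_mul_le _ _).trans (mul_le_mul_of_nonneg_right (norm_mul_le _ _) (norm_nonneg _))
      _ ≤ 1 * (1 + ε) * (1 + ε) ^ l.length := by
          gcongr
          · exact (hU ν _).2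
          · exact hr.2
      _ = (1 + ε) ^ l.length * (1 + ε) := by ring

/-- the norm of the INVERSE of a product run: `‖((U′U)(Γ))⁻¹‖ ≤ (1+ε)^{|Γ|}`. [cite: Balaban1985BackgroundPropagators, (3.55) p.401, (3.3) p.391] -/
theorem norm_inv_stepRun_prod_le {U U' : CfgV1 P 𝔸} (hU : ∀ μ x, UnitaryLike (U μ x)) {ε : ℝ} (hε : 0 ≤ ε) :
    ∀ (l : List (Fin P.d × Bool)) (w : Site P 0),
      (∀ r ∈ rungSites l w, ‖((U' r.2.1 r.1 : 𝔸ˣ) : 𝔸)‖ ≤ 1 + ε ∧ ‖(((U' r.2.1 r.1)⁻¹ : 𝔸ˣ) : 𝔸)‖ ≤ 1 + ε) →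
        ‖(((stepRun (fun μ x => U' μ x * U μ x) l w)⁻¹ : 𝔸ˣ) : 𝔸)‖ ≤ (1 + ε) ^ l.length
  | [], _, _ => by simp [stepRun]
  | (ν, true) :: l, w, h => by
    simp only [stepRun, mul_inv_rev, Units.val_mul, List.length_cons, pow_succ]
    have hr := h (w, ν, true) (by simp [rungSites])
    have ih := norm_inv_stepRun_prod_le hU hε l (w.shift ν) fun r hr' => h r (by simp [rungSites, hr'])
    calc ‖((((stepRun (fun μ x => U' μ x * U μ x) l (w.shift ν))⁻¹ : 𝔸ˣ) : 𝔸)) *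
          ((((U ν w)⁻¹ : 𝔸ˣ) : 𝔸) * (((U' ν w)⁻¹ : 𝔸ˣ) : 𝔸))‖
        ≤ ‖(((stepRun (fun μ x => U' μ x * U μ x) l (w.shift ν))⁻¹ : 𝔸ˣ) : 𝔸)‖ *
            (‖(((U ν w)⁻¹ : 𝔸ˣ) : 𝔸)‖ * ‖(((U' ν w)⁻¹ : 𝔸ˣ) : 𝔸)‖) :=
          (norm_mul_le _ _).trans (mul_le_mul_of_nonneg_left (norm_mul_le _ _) (norm_nonneg _))
      _ ≤ (1 + ε) ^ l.length * (1 * (1 + ε)) := by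
          gcongr
          · exact (hU ν w).2
          · exact hr.2
      _ = (1 + ε) ^ l.length * (1 + ε) := by ring
  | (ν, false) :: l, w, h => by
    simp only [stepRun, mul_inv_rev, inv_inv, Units.val_mul, List.length_cons, pow_succ]
    have hr := h (w.unshift ν, ν, false) (by simp [rungSites])
    have ih := norm_inv_stepRun_prod_le hU hε l (w.unshift ν) fun r hr' => h r (by simp [rungSites, hr'])
    calc ‖((((stepRun (fun μ x => U' μ x * U μ x) l (w.unshift ν))⁻¹ : 𝔸ˣ) : 𝔸)) *
          ((U' ν (w.unshift ν) : 𝔸) * (U ν (w.unshift ν) : 𝔸))‖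
        ≤ ‖(((stepRun (fun μ x => U' μ x * U μ x) l (w.unshift ν))⁻¹ : 𝔸ˣ) : 𝔸)‖ *
            (‖(U' ν (w.unshift ν) : 𝔸)‖ * ‖(U ν (w.unshift ν) : 𝔸)‖) :=
          (norm_mul_le _ _).trans (mul_le_mul_of_nonneg_left (norm_mul_le _ _) (norm_nonneg _))
      _ ≤ (1 + ε) ^ l.length * ((1 + ε) * 1) := by
          gcongr
          · exact hr.1
          · exact (hU ν _).1
      _ = (1 + ε) ^ l.length * (1 + ε) := by ring

/-- ★ **THE PRODUCT DEFECT** (the key estimate of p. 401 in product form): if `U` is unitary-like and `‖U′(b) − 1‖ ≤ ε`, `‖U′(b)⁻¹ − 1‖ ≤ ε` at every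
traversed bond, then `‖(U′U)(Γ) − U(Γ)‖ ≤ (1+ε)^{|Γ|} − 1`. [cite: Balaban1985BackgroundPropagators, p.401 («|(U′U)(Γ)(U(Γ))⁻¹ − 1| < O(1)α₁»), (3.55) p.401] -/
theorem norm_stepRun_prod_sub_le {U U' : CfgV1 P 𝔸} (hU : ∀ μ x, UnitaryLike (U μ x)) {ε : ℝ} (hε : 0 ≤ ε) :
    ∀ (l : List (Fin P.d × Bool)) (w : Site P 0),
      (∀ r ∈ rungSites l w, ‖((U' r.2.1 r.1 : 𝔸ˣ) : 𝔸) - 1‖ ≤ ε ∧ ‖(((U' r.2.1 r.1)⁻¹ : 𝔸ˣ) : 𝔸) - 1‖ ≤ ε) →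
        ‖((stepRun (fun μ x => U' μ x * U μ x) l w : 𝔸ˣ) : 𝔸) - (stepRun U l w : 𝔸)‖ ≤ (1 + ε) ^ l.length - 1
  | [], _, _ => by simp [stepRun]
  | (ν, true) :: l, w, h => by
    simp only [stepRun, Units.val_mul, List.length_cons, pow_succ]
    have hr := h (w, ν, true) (by simp [rungSites])
    have h' : ∀ r ∈ rungSites l (w.shift ν), ‖((U' r.2.1 r.1 : 𝔸ˣ) : 𝔸) - 1‖ ≤ ε ∧ ‖(((U' r.2.1 r.1)⁻¹ : 𝔸ˣ) : 𝔸) - 1‖ ≤ ε :=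
      fun r hr' => h r (by simp [rungSites, hr'])
    have hb : ∀ r ∈ rungSites l (w.shift ν), ‖((U' r.2.1 r.1 : 𝔸ˣ) : 𝔸)‖ ≤ 1 + ε ∧ ‖(((U' r.2.1 r.1)⁻¹ : 𝔸ˣ) : 𝔸)‖ ≤ 1 + ε := fun r hr' => by
      obtain ⟨h1, h2⟩ := h' r hr'
      exact ⟨by simpa using (norm_le_norm_add_norm_sub' ((U' r.2.1 r.1 : 𝔸ˣ) : 𝔸) 1).trans (by rw [norm_one]; linarith),
        by simpa using (norm_le_norm_add_norm_sub' (((U' r.2.1 r.1)⁻¹ : 𝔸ˣ) : 𝔸) 1).trans (by rw [norm_one]; linarith)⟩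
    have ih := norm_stepRun_prod_sub_le hU hε l (w.shift ν) h'
    have hX := norm_stepRun_prod_le hU hε l (w.shift ν) hb
    set X' : 𝔸 := (stepRun (fun μ x => U' μ x * U μ x) l (w.shift ν) : 𝔸)
    set X : 𝔸 := (stepRun U l (w.shift ν) : 𝔸)
    have hsplit : (U' ν w : 𝔸) * (U ν w : 𝔸) * X' - (U ν w : 𝔸) * X
        = ((U' ν w : 𝔸) - 1) * ((U ν w : 𝔸) * X') + (U ν w : 𝔸) * (X' - X) := by noncomm_ring
    rw [hsplit]
    calc ‖((U' ν w : 𝔸) - 1) * ((U ν w : 𝔸) * X') + (U ν w : 𝔸) * (X' - X)‖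
        ≤ ‖(U' ν w : 𝔸) - 1‖ * (‖(U ν w : 𝔸)‖ * ‖X'‖) + ‖(U ν w : 𝔸)‖ * ‖X' - X‖ :=
          (norm_add_le _ _).trans (add_le_add ((norm_mul_le _ _).trans (mul_le_mul_of_nonneg_left (norm_mul_le _ _) (norm_nonneg _)))
            (norm_mul_le _ _))
      _ ≤ ε * (1 * (1 + ε) ^ l.length) + 1 * ((1 + ε) ^ l.length - 1) := by
          gcongr
          · exact hr.1
          · exact (hU ν w).1
          · exact (hU ν w).1
      _ = (1 + ε) ^ l.length * (1 + ε) - 1 := by ring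
  | (ν, false) :: l, w, h => by
    simp only [stepRun, mul_inv_rev, Units.val_mul, List.length_cons, pow_succ]
    have hr := h (w.unshift ν, ν, false) (by simp [rungSites])
    have h' : ∀ r ∈ rungSites l (w.unshift ν), ‖((U' r.2.1 r.1 : 𝔸ˣ) : 𝔸) - 1‖ ≤ ε ∧ ‖(((U' r.2.1 r.1)⁻¹ : 𝔸ˣ) : 𝔸) - 1‖ ≤ ε :=
      fun r hr' => h r (by simp [rungSites, hr'])
    have hb : ∀ r ∈ rungSites l (w.unshift ν), ‖((U' r.2.1 r.1 : 𝔸ˣ) : 𝔸)‖ ≤ 1 + ε ∧ ‖(((U' r.2.1 r.1)⁻¹ : 𝔸ˣ) : 𝔸)‖ ≤ 1 + ε := fun r hr' => by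
      obtain ⟨h1, h2⟩ := h' r hr'
      exact ⟨by simpa using (norm_le_norm_add_norm_sub' ((U' r.2.1 r.1 : 𝔸ˣ) : 𝔸) 1).trans (by rw [norm_one]; linarith),
        by simpa using (norm_le_norm_add_norm_sub' (((U' r.2.1 r.1)⁻¹ : 𝔸ˣ) : 𝔸) 1).trans (by rw [norm_one]; linarith)⟩
    have ih := norm_stepRun_prod_sub_le hU hε l (w.unshift ν) h'
    have hX := norm_stepRun_prod_le hU hε l (w.unshift ν) hb
    set X' : 𝔸 := (stepRun (fun μ x => U' μ x * U μ x) l (w.unshift ν) : 𝔸)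
    set X : 𝔸 := (stepRun U l (w.unshift ν) : 𝔸)
    set u : 𝔸 := (((U ν (w.unshift ν))⁻¹ : 𝔸ˣ) : 𝔸)
    set u' : 𝔸 := (((U' ν (w.unshift ν))⁻¹ : 𝔸ˣ) : 𝔸)
    have hsplit : u * u' * X' - u * X = u * ((u' - 1) * X') + u * (X' - X) := by noncomm_ring
    rw [hsplit]
    calc ‖u * ((u' - 1) * X') + u * (X' - X)‖
        ≤ ‖u‖ * (‖u' - 1‖ * ‖X'‖) + ‖u‖ * ‖X' - X‖ :=
          (norm_add_le _ _).trans (add_le_add ((norm_mul_le _ _).trans (mul_le_mul_of_nonneg_left (norm_mul_le _ _) (norm_nonneg _)))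
            (norm_mul_le _ _))
      _ ≤ 1 * (ε * (1 + ε) ^ l.length) + 1 * ((1 + ε) ^ l.length - 1) := by
          gcongr
          · exact (hU ν _).2
          · exact hr.2
          · exact (hU ν _).2
      _ = (1 + ε) ^ l.length * (1 + ε) - 1 := by ring

/-- ★ **THE PRODUCT DEFECT OF THE INVERSES**: `‖((U′U)(Γ))⁻¹ − (U(Γ))⁻¹‖ ≤ (1+ε)^{|Γ|}·((1+ε)^{|Γ|} − 1)`
(`p′⁻¹ − p⁻¹ = p′⁻¹(p − p′)p⁻¹`). [cite: Balaban1985BackgroundPropagators, p.401, (3.55) p.401] -/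
theorem norm_inv_stepRun_prod_sub_le {U U' : CfgV1 P 𝔸} (hU : ∀ μ x, UnitaryLike (U μ x)) {ε : ℝ} (hε : 0 ≤ ε)
    (l : List (Fin P.d × Bool)) (w : Site P 0)
    (h : ∀ r ∈ rungSites l w, ‖((U' r.2.1 r.1 : 𝔸ˣ) : 𝔸) - 1‖ ≤ ε ∧ ‖(((U' r.2.1 r.1)⁻¹ : 𝔸ˣ) : 𝔸) - 1‖ ≤ ε) :
    ‖(((stepRun (fun μ x => U' μ x * U μ x) l w)⁻¹ : 𝔸ˣ) : 𝔸) - (((stepRun U l w)⁻¹ : 𝔸ˣ) : 𝔸)‖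
      ≤ (1 + ε) ^ l.length * ((1 + ε) ^ l.length - 1) := by
  have hb : ∀ r ∈ rungSites l w, ‖((U' r.2.1 r.1 : 𝔸ˣ) : 𝔸)‖ ≤ 1 + ε ∧ ‖(((U' r.2.1 r.1)⁻¹ : 𝔸ˣ) : 𝔸)‖ ≤ 1 + ε := fun r hr' => by
    obtain ⟨h1, h2⟩ := h r hr'
    exact ⟨by simpa using (norm_le_norm_add_norm_sub' ((U' r.2.1 r.1 : 𝔸ˣ) : 𝔸) 1).trans (by rw [norm_one]; linarith),
      by simpa using (norm_le_norm_add_norm_sub' (((U' r.2.1 r.1)⁻¹ : 𝔸ˣ) : 𝔸) 1).trans (by rw [norm_one]; linarith)⟩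
  set p' : 𝔸ˣ := stepRun (fun μ x => U' μ x * U μ x) l w
  set p : 𝔸ˣ := stepRun U l w
  have hid : ((p'⁻¹ : 𝔸ˣ) : 𝔸) - ((p⁻¹ : 𝔸ˣ) : 𝔸) = ((p'⁻¹ : 𝔸ˣ) : 𝔸) * ((p : 𝔸) - (p' : 𝔸)) * ((p⁻¹ : 𝔸ˣ) : 𝔸) := by
    rw [mul_sub, sub_mul, Units.mul_inv_cancel_right, Units.inv_mul, one_mul]
  rw [hid]
  have h1 := norm_inv_stepRun_prod_le hU hε l w hb
  have h2 := norm_stepRun_prod_sub_le hU hε l w h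
  have h3 : ‖((p⁻¹ : 𝔸ˣ) : 𝔸)‖ ≤ 1 := (unitaryLike_stepRun hU l w).2
  calc ‖((p'⁻¹ : 𝔸ˣ) : 𝔸) * ((p : 𝔸) - (p' : 𝔸)) * ((p⁻¹ : 𝔸ˣ) : 𝔸)‖
      ≤ ‖((p'⁻¹ : 𝔸ˣ) : 𝔸)‖ * ‖(p : 𝔸) - (p' : 𝔸)‖ * ‖((p⁻¹ : 𝔸ˣ) : 𝔸)‖ :=
        (norm_mul_le _ _).trans (mul_le_mul_of_nonneg_right (norm_mul_le _ _) (norm_nonneg _))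
    _ ≤ (1 + ε) ^ l.length * ((1 + ε) ^ l.length - 1) * 1 := by
        rw [norm_sub_rev]
        have h0 : 0 ≤ (1 + ε) ^ l.length - 1 := by
          have := one_le_pow₀ (show (1 : ℝ) ≤ 1 + ε by linarith) (n := l.length); linarith
        gcongr
    _ = _ := by ring

/-- the arithmetic «(1+ε)ⁿ − 1 ≦ nε·e^{nε}» («α₁ sufficiently small» made a number). [folklore] -/
private theorem pow_sub_one_le {ε : ℝ} (hε : 0 ≤ ε) (n : ℕ) : (1 + ε) ^ n - 1 ≤ n * ε * Real.exp (n * ε) := by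
  have h1 : (1 + ε) ^ n ≤ Real.exp (n * ε) := by
    calc (1 + ε) ^ n ≤ (Real.exp ε) ^ n := pow_le_pow_left₀ (by linarith) (by linarith [Real.add_one_le_exp ε]) n
      _ = Real.exp (n * ε) := by rw [← Real.exp_nat_mul]
  have h2 : Real.exp (n * ε) - 1 ≤ n * ε * Real.exp (n * ε) := by
    have h := Real.add_one_le_exp (-(n * ε))
    have hpos := Real.exp_pos (n * ε)
    have h3 : (-(n * ε) + 1) * Real.exp (n * ε) ≤ Real.exp (-(n * ε)) * Real.exp (n * ε) := mul_le_mul_of_nonneg_right h hpos.le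
    rw [← Real.exp_add, neg_add_cancel, Real.exp_zero] at h3
    nlinarith
  linarith

/-- the arithmetic «(1+ε)ⁿ ≦ e^{nε}». [folklore] -/
private theorem pow_le_exp {ε : ℝ} (hε : 0 ≤ ε) (n : ℕ) : (1 + ε) ^ n ≤ Real.exp (n * ε) := by
  calc (1 + ε) ^ n ≤ (Real.exp ε) ^ n := pow_le_pow_left₀ (by linarith) (by linarith [Real.add_one_le_exp ε]) n
    _ = Real.exp (n * ε) := by rw [← Real.exp_nat_mul]

end Product

/-! ## §2 The adjoint-action letters `Rclm` -/

section Rclm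

variable {𝔸 : Type} [NormedRing 𝔸] [NormedAlgebra ℂ 𝔸]

open B9Eq360DeltaPrimeAY (Rclm)

/-- ★ **THE DIFFERENCE OF TWO ADJOINT ACTIONS** (as `ℝ`-continuous-linear letters of `𝔸`): `‖R(p′) − R(p)‖ ≤ ‖p′ − p‖·‖p′⁻¹‖ + ‖p‖·‖p′⁻¹ − p⁻¹‖`
(`p′Xp′⁻¹ − pXp⁻¹ = (p′ − p)Xp′⁻¹ + pX(p′⁻¹ − p⁻¹)`). [cite: Balaban1985BackgroundPropagators, (3.57)–(3.58) pp.401–402 («F′₂ = Q′(U′U) − Q′(U)»), (3.1) p.390] -/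
theorem norm_Rclm_sub_le (p' p : 𝔸ˣ) :
    ‖Rclm p' - Rclm p‖ ≤ ‖(p' : 𝔸) - (p : 𝔸)‖ * ‖((p'⁻¹ : 𝔸ˣ) : 𝔸)‖ + ‖(p : 𝔸)‖ * ‖((p'⁻¹ : 𝔸ˣ) : 𝔸) - ((p⁻¹ : 𝔸ˣ) : 𝔸)‖ := by
  refine ContinuousLinearMap.opNorm_le_bound _ (by positivity) fun X => ?_
  have hval : (Rclm p' - Rclm p) X = ((p' : 𝔸) - (p : 𝔸)) * X * ((p'⁻¹ : 𝔸ˣ) : 𝔸) + (p : 𝔸) * X * (((p'⁻¹ : 𝔸ˣ) : 𝔸) - ((p⁻¹ : 𝔸ˣ) : 𝔸)) := by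
    simp only [Rclm, FunLike.coe_sub, Pi.sub_apply, ContinuousLinearMap.mulLeftRight_apply]
    noncomm_ring
  rw [hval]
  calc ‖((p' : 𝔸) - (p : 𝔸)) * X * ((p'⁻¹ : 𝔸ˣ) : 𝔸) + (p : 𝔸) * X * (((p'⁻¹ : 𝔸ˣ) : 𝔸) - ((p⁻¹ : 𝔸ˣ) : 𝔸))‖
      ≤ ‖(p' : 𝔸) - (p : 𝔸)‖ * ‖X‖ * ‖((p'⁻¹ : 𝔸ˣ) : 𝔸)‖ + ‖(p : 𝔸)‖ * ‖X‖ * ‖((p'⁻¹ : 𝔸ˣ) : 𝔸) - ((p⁻¹ : 𝔸ˣ) : 𝔸)‖ :=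
        (norm_add_le _ _).trans (add_le_add ((norm_mul_le _ _).trans (mul_le_mul_of_nonneg_right (norm_mul_le _ _) (norm_nonneg _)))
          ((norm_mul_le _ _).trans (mul_le_mul_of_nonneg_right (norm_mul_le _ _) (norm_nonneg _))))
    _ = _ := by ring

end Rclm

/-! ## §3 Geometry at NODE 00: the taxicab path from the block corner stays in the block -/

section Geometry

open B4Reflection242 (boxDom mem_boxDom blk)
open B6MultiLevelBoxOperator (N0)
open B6Geom246MultiLevelBox (bset blkOf blkOf_eq_iff_blk coord_bounds corner scale_bounds)
open B6GlobalChartV1 (PV toBox boxEquiv toBox_apply boxEquiv_apply val_boxEquiv_symm)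
open B6KLevelCensusIndexV1 (KIdx)
open B9Eq340TaxiRungs (OnArc onArc_left rungSites_taxiSteps onArc_mem_interval length_taxiSteps_le)
open Node00 (SiteY BlkY blkCornerY)

variable {d ℓ : ℕ} {hd : 1 ≤ d + 1} {hL : Odd (ℓ + 1) ∧ 1 < ℓ + 1} {b₀ b₁ : ℝ} (i : KIdx d ℓ hd hL b₀ b₁)

/-- the labels of the inverse chart, as naturals: `((boxEquiv⁻¹ z) μ).val = z_μ`. [cite: Balaban1984PropagatorsII, (2.1) p.224, dictionary] -/
theorem val_boxEquiv_symm_int (z : SiteY i) (μ : Fin (d + 1)) : ((((boxEquiv i.hN).symm z) μ).val : ℤ) = z.1 μ :=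
  val_boxEquiv_symm i.hN z μ

/-- the period is a multiple of `Lʲ` for every block level `j ≤ k`, and `2Lʲ ≤ period` (`M_h ≥ 8`).
[cite: Balaban1984PropagatorsII, (2.1) p.224, bookkeeping] -/
theorem pow_dvd_period_and_two_mul_le (s : BlkY i) :
    ((ℓ + 1) ^ s.1.1 ∣ (PV d ℓ i.m i.K hd hL).sitesPerDir 0) ∧ 2 * (ℓ + 1) ^ s.1.1 ≤ (PV d ℓ i.m i.K hd hL).sitesPerDir 0 := by
  have hj : s.1.1 ≤ i.k := (scale_bounds i.D.toDomains s).2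
  rw [← i.hN 0]
  show ((ℓ + 1) ^ s.1.1 ∣ (ℓ + 1) ^ i.k * ((ℓ + 1) * (i.Mh * i.P' 0))) ∧ 2 * (ℓ + 1) ^ s.1.1 ≤ (ℓ + 1) ^ i.k * ((ℓ + 1) * (i.Mh * i.P' 0))
  refine ⟨Dvd.dvd.mul_right (pow_dvd_pow _ hj) _, ?_⟩
  have h8 : 8 ≤ i.Mh := i.hM8
  have h5 : 5 ≤ i.P' 0 := i.hP5 0
  have hpow : (ℓ + 1) ^ s.1.1 ≤ (ℓ + 1) ^ i.k := Nat.pow_le_pow_right (by omega) hj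
  have h40 : 40 ≤ i.Mh * i.P' 0 := le_trans (by norm_num) (Nat.mul_le_mul h8 h5)
  have h40' : 40 ≤ (ℓ + 1) * (i.Mh * i.P' 0) := le_trans h40 (Nat.le_mul_of_pos_left _ (by omega))
  calc 2 * (ℓ + 1) ^ s.1.1 ≤ 2 * (ℓ + 1) ^ i.k := Nat.mul_le_mul_left _ hpow
    _ ≤ ((ℓ + 1) * (i.Mh * i.P' 0)) * (ℓ + 1) ^ i.k := Nat.mul_le_mul_right _ (le_trans (by norm_num) h40')
    _ = (ℓ + 1) ^ i.k * ((ℓ + 1) * (i.Mh * i.P' 0)) := by ring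

/-- **THE TORUS COUNTS FROM THE CORNER ARE THE BOX DIFFERENCES**: for `z ∈ Δ(s)`, with `p`, `t` the torus points of the corner `c_s` and of `z`,
`((t_μ − p_μ).val : ℤ) = z_μ − c_μ` and `(t_μ − p_μ).val < Lʲ`. [cite: Balaban1984PropagatorsII, (2.1) p.224, dictionary] -/
theorem val_sub_corner (s : BlkY i) {z : SiteY i} (hz : blkOf i.D.toDomains z = s) (μ : Fin (d + 1)) :
    (((((boxEquiv i.hN).symm z) μ - ((boxEquiv i.hN).symm (blkCornerY i s)) μ).val : ℕ) : ℤ) = z.1 μ - (corner i.D.toDomains s) μ ∧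
      (((boxEquiv i.hN).symm z) μ - ((boxEquiv i.hN).symm (blkCornerY i s)) μ).val < (ℓ + 1) ^ s.1.1 := by
  obtain ⟨h1, h2⟩ := coord_bounds i.D.toDomains hz μ
  have hc : (corner i.D.toDomains s) μ = (((ℓ + 1) ^ s.1.1 : ℕ) : ℤ) * s.1.2 μ := rfl
  have ht : ((((boxEquiv i.hN).symm z) μ).val : ℤ) = z.1 μ := val_boxEquiv_symm_int i z μ
  have hp : ((((boxEquiv i.hN).symm (blkCornerY i s)) μ).val : ℤ) = (corner i.D.toDomains s) μ := val_boxEquiv_symm_int i (blkCornerY i s) μ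
  have hle : (((boxEquiv i.hN).symm (blkCornerY i s)) μ).val ≤ (((boxEquiv i.hN).symm z) μ).val := by
    have : ((((boxEquiv i.hN).symm (blkCornerY i s)) μ).val : ℤ) ≤ ((((boxEquiv i.hN).symm z) μ).val : ℤ) := by rw [ht, hp, hc]; exact h1
    exact_mod_cast this
  have hsub := ZMod.val_sub hle
  have e : (((((boxEquiv i.hN).symm z) μ - ((boxEquiv i.hN).symm (blkCornerY i s)) μ).val : ℕ) : ℤ) = z.1 μ - (corner i.D.toDomains s) μ := by
    rw [hsub, Nat.cast_sub hle, ht, hp]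
  refine ⟨e, ?_⟩
  have : (((((boxEquiv i.hN).symm z) μ - ((boxEquiv i.hN).symm (blkCornerY i s)) μ).val : ℕ) : ℤ) < (((ℓ + 1) ^ s.1.1 : ℕ) : ℤ) := by
    rw [e, hc]; linarith
  exact_mod_cast this

/-- ★ **A TORUS POINT WITHIN `Lʲ` STEPS OF THE CORNER (coordinatewise, forward) LIES IN THE BLOCK**: if `(u_μ − p_μ).val < Lʲ` for every `μ`
(`p` the corner's torus point), then the charted point `toBox u` lies in `Δ(s)`. [cite: Balaban1984PropagatorsII, (2.1) p.224, dictionary] -/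
theorem blkOf_toBox_of_val_sub_lt (s : BlkY i) (u : Site (PV d ℓ i.m i.K hd hL) 0)
    (hu : ∀ μ, (u μ - ((boxEquiv i.hN).symm (blkCornerY i s)) μ).val < (ℓ + 1) ^ s.1.1) :
    blkOf i.D.toDomains (toBox i.hN u) = s := by
  set p := (boxEquiv i.hN).symm (blkCornerY i s) with hpdef
  have hLj0 : 0 < (ℓ + 1) ^ s.1.1 := by positivity
  have hLz : (0 : ℤ) < (((ℓ + 1) ^ s.1.1 : ℕ) : ℤ) := by exact_mod_cast hLj0
  obtain ⟨hdvd, h2⟩ := pow_dvd_period_and_two_mul_le i s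
  rw [blkOf_eq_iff_blk]
  funext μ
  -- the corner coordinate `c_μ = Lʲ·y_μ`, `0 ≤ c_μ`, `c_μ + Lʲ ≤ period`
  have hc : (corner i.D.toDomains s) μ = (((ℓ + 1) ^ s.1.1 : ℕ) : ℤ) * s.1.2 μ := rfl
  have hp : (((p μ).val : ℕ) : ℤ) = (corner i.D.toDomains s) μ := val_boxEquiv_symm_int i (blkCornerY i s) μ
  have hcmem := (mem_boxDom.1 (blkCornerY i s).2) μ
  have hcN : (corner i.D.toDomains s) μ < ((N0 ℓ i.Mh i.k i.P' μ : ℕ) : ℤ) := hcmem.2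
  have hN : N0 ℓ i.Mh i.k i.P' μ = (PV d ℓ i.m i.K hd hL).sitesPerDir 0 := i.hN μ
  -- `c_μ + Lʲ ≤ period` since `Lʲ ∣ period` and `Lʲ ∣ c_μ`
  have hcL : (corner i.D.toDomains s) μ + (((ℓ + 1) ^ s.1.1 : ℕ) : ℤ) ≤ (((PV d ℓ i.m i.K hd hL).sitesPerDir 0 : ℕ) : ℤ) := by
    rw [hN] at hcN
    obtain ⟨N', hN'⟩ := hdvd
    rw [hN', hc, Nat.cast_mul] at hcN ⊢
    have hy : s.1.2 μ < (N' : ℤ) := lt_of_mul_lt_mul_left hcN hLz.le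
    have hy' : s.1.2 μ + 1 ≤ (N' : ℤ) := hy
    calc (((ℓ + 1) ^ s.1.1 : ℕ) : ℤ) * s.1.2 μ + (((ℓ + 1) ^ s.1.1 : ℕ) : ℤ) = (((ℓ + 1) ^ s.1.1 : ℕ) : ℤ) * (s.1.2 μ + 1) := by ring
      _ ≤ (((ℓ + 1) ^ s.1.1 : ℕ) : ℤ) * (N' : ℤ) := mul_le_mul_of_nonneg_left hy' hLz.le
  -- `(u_μ).val = (u_μ − p_μ).val + (p_μ).val` (no wrap)
  have hrL : (((u μ - p μ).val : ℕ) : ℤ) < (((ℓ + 1) ^ s.1.1 : ℕ) : ℤ) := by exact_mod_cast hu μ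
  have hsum : (u μ).val = (u μ - p μ).val + (p μ).val := by
    have hlt : (u μ - p μ).val + (p μ).val < (PV d ℓ i.m i.K hd hL).sitesPerDir 0 := by
      have : (((u μ - p μ).val + (p μ).val : ℕ) : ℤ) < (((PV d ℓ i.m i.K hd hL).sitesPerDir 0 : ℕ) : ℤ) := by
        rw [Nat.cast_add, hp]; linarith
      exact_mod_cast this
    have := ZMod.val_add_of_lt hlt
    rwa [sub_add_cancel] at this
  -- the box coordinate of `u` lies in `[c_μ, c_μ + Lʲ)`
  have hcoord : (toBox i.hN u : Fin (d + 1) → ℤ) μ = (((u μ - p μ).val : ℕ) : ℤ) + (corner i.D.toDomains s) μ := by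
    rw [toBox_apply, hsum, Nat.cast_add, hp]
  show (toBox i.hN u : Fin (d + 1) → ℤ) μ / (((ℓ + 1) ^ s.1.1 : ℕ) : ℤ) = s.1.2 μ
  rw [hcoord, hc, Int.add_mul_ediv_left _ _ hLz.ne']
  have hr0 : (0 : ℤ) ≤ (((u μ - p μ).val : ℕ) : ℤ) := by positivity
  rw [Int.ediv_eq_zero_of_lt hr0 hrL, zero_add]

/-- ★ **EVERY RUNG OF A TAXICAB PATH BETWEEN TWO POINTS OF THE BLOCK LIES IN THE BLOCK**: for torus points `x₁, x₂` with all coordinates within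
`Lʲ` forward steps of the corner (e.g. the corner and a site of the block, in either order), every rung site of `taxiSteps (all directions) x₁ x₂`
charts into `Δ(s)` (the shorter arcs stay in the coordinate intervals since `2Lʲ ≤ period`).
[cite: Balaban1985BackgroundPropagators, (3.40) p.397 («a shortest contour»), (3.19) p.393; Balaban1984PropagatorsII, (2.1) p.224] -/
theorem blkOf_toBox_rung_eq (s : BlkY i) (x₁ x₂ : Site (PV d ℓ i.m i.K hd hL) 0)
    (h₁ : ∀ μ, (x₁ μ - ((boxEquiv i.hN).symm (blkCornerY i s)) μ).val < (ℓ + 1) ^ s.1.1)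
    (h₂ : ∀ μ, (x₂ μ - ((boxEquiv i.hN).symm (blkCornerY i s)) μ).val < (ℓ + 1) ^ s.1.1)
    (r : Site (PV d ℓ i.m i.K hd hL) 0 × Fin (d + 1) × Bool)
    (hr : r ∈ rungSites (taxiSteps (List.finRange (d + 1)) x₁ x₂) x₁) :
    blkOf i.D.toDomains (toBox i.hN r.1) = s := by
  obtain ⟨-, h2⟩ := pow_dvd_period_and_two_mul_le i s
  obtain ⟨-, -, hon⟩ := rungSites_taxiSteps x₂ (List.finRange (d + 1)) (List.nodup_finRange _) x₁ r hr
  refine blkOf_toBox_of_val_sub_lt i s r.1 fun μ => ?_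
  exact onArc_mem_interval h2 (h₁ μ) (h₂ μ) (hon μ (List.mem_finRange μ)).1

/-- the taxicab path between two points of the block has at most `(d+1)·(Lʲ−1)` steps.
[cite: Balaban1985BackgroundPropagators, (3.40) p.397, (3.19) p.393; Balaban1984PropagatorsII, (2.1) p.224] -/
theorem length_taxiSteps_block_le (s : BlkY i) (x₁ x₂ : Site (PV d ℓ i.m i.K hd hL) 0)
    (h : ∀ μ, min (x₂ μ - x₁ μ).val (x₁ μ - x₂ μ).val ≤ (ℓ + 1) ^ s.1.1 - 1) :
    (taxiSteps (List.finRange (d + 1)) x₁ x₂).length ≤ (d + 1) * ((ℓ + 1) ^ s.1.1 - 1) := by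
  have hlen := length_taxiSteps_le x₁ x₂ h (List.finRange (d + 1))
  rwa [List.length_finRange] at hlen

end Geometry

/-! ## §4 ★★ The key estimate for the taxicab transporter and (3.58)∕(3.59) for NODE 00's letters -/

section Estimate

open B4Reflection242 (boxDom mem_boxDom blk)
open B6MultiLevelBoxOperator (N0)
open B6Geom246MultiLevelBox (bset blkOf blkOf_eq_iff_blk coord_bounds corner scale_bounds)
open B6GlobalChartV1 (PV toBox boxEquiv toBox_apply boxEquiv_apply val_boxEquiv_symm)
open B6KLevelCensusIndexV1 (KIdx kGeo)
open B9Eq39Adjoint (R fluct)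
open B9Eq369Product (val_fluct val_inv_fluct)
open B9Eq370Expansion (norm_Iη_smul norm_exp_neg_sub_one_le')
open Beta.TransportVertices (norm_exp_sub_one_le_expTail expTail_one)
open B9Eq340TaxiRungs (OnArc onArc_left rungSites_taxiSteps onArc_mem_interval length_taxiSteps_le)
open B9Eq360DeltaPrimeAY (Rclm kQY sQY kFY sFY mulY AfldY blkY blkY_apply)
open B9Thm311ReadingAtLetters (wB wB_pos)
open B9SectBGpLettersY (norm_le_one_and_inv_of_mem)
open Node00 (SiteY BlkY CfgY SiteParY blkCornerY parTaxiV parSY parSymY parSymY_of_le parSymY_of_not_le)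

variable {𝔸 : Type} [NormedRing 𝔸] [NormedAlgebra ℂ 𝔸] [CompleteSpace 𝔸] [NormOneClass 𝔸]
variable {d ℓ : ℕ} {hd : 1 ≤ d + 1} {hL : Odd (ℓ + 1) ∧ 1 < ℓ + 1} {b₀ b₁ : ℝ} (i : KIdx d ℓ hd hL b₀ b₁) (G : Subgroup 𝔸ˣ)

omit [NormOneClass 𝔸] in
/-- **THE SIZE OF ONE MULTIPLIER** from the pointwise (3.37)-type bound: if `η‖a_ν(v)‖ ≤ x ≤ 1/4` then `‖e^{iηa_ν(v)} − 1‖ ≤ 2x` and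
`‖e^{−iηa_ν(v)} − 1‖ ≤ 2x` (`e^{1/4} ≤ 2`). [cite: Balaban1985BackgroundPropagators, (3.37) p.396, p.401 («|Q_l(U, ξA′)| < 2α₁L^lξ»)] -/
theorem norm_fluct_sub_one_le {η : ℝ} (hη : 0 ≤ η) (a : AfldY 𝔸 i) (ν : Fin (d + 1)) (v : Site (PV d ℓ i.m i.K hd hL) 0) {x : ℝ}
    (hx : η * ‖a ν v‖ ≤ x) (hx4 : x ≤ 1 / 4) :
    ‖((fluct η a ν v : 𝔸ˣ) : 𝔸) - 1‖ ≤ 2 * x ∧ ‖(((fluct η a ν v)⁻¹ : 𝔸ˣ) : 𝔸) - 1‖ ≤ 2 * x := by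
  have hX : ‖((I * η : ℂ)) • a ν v‖ = η * ‖a ν v‖ := norm_Iη_smul hη _
  have hx0 : 0 ≤ η * ‖a ν v‖ := mul_nonneg hη (norm_nonneg _)
  have hexp : Real.exp (η * ‖a ν v‖) - 1 ≤ 2 * x := by
    have h1 : Real.exp (η * ‖a ν v‖) ≤ Real.exp x := Real.exp_le_exp.2 hx
    have h2 : Real.exp x - 1 ≤ x * Real.exp x := by
      have h := Real.add_one_le_exp (-x)
      have hpos := Real.exp_pos x
      have h3 : (-x + 1) * Real.exp x ≤ Real.exp (-x) * Real.exp x := mul_le_mul_of_nonneg_right h hpos.le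
      rw [← Real.exp_add, neg_add_cancel, Real.exp_zero] at h3
      nlinarith
    have h3 : Real.exp x ≤ 2 := by
      have h4 : Real.exp x ≤ Real.exp (1 / 4) := Real.exp_le_exp.2 hx4
      have h5 : Real.exp (1 / 4) ≤ 2 := by
        have := B9Eq352ScalarFluct.exp_two_mul_le_two (t := 1 / 8) (by norm_num)
        norm_num at this; exact this
      exact h4.trans h5
    have hx' : 0 ≤ x := hx0.trans hx
    nlinarith
  constructor
  · rw [val_fluct]
    have h := norm_exp_sub_one_le_expTail ℂ (((I * η : ℂ)) • a ν v)
    rw [expTail_one, hX] at h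
    exact h.trans hexp
  · rw [val_inv_fluct]
    have h := norm_exp_neg_sub_one_le' (((I * η : ℂ)) • a ν v)
    rw [hX] at h
    exact h.trans hexp

/-- `min((x₂−x₁).val, (x₁−x₂).val) ≤ Lʲ − 1` for two points within `Lʲ` forward steps of the corner. [cite: Balaban1985BackgroundPropagators, (3.40) p.397, bookkeeping] -/
theorem min_val_sub_le {n : ℕ} [NeZero n] {c a b : ZMod n} {Lj : ℕ} (ha : (a - c).val < Lj) (hb : (b - c).val < Lj) :
    min (b - a).val (a - b).val ≤ Lj - 1 := by
  rcases le_total (a - c).val (b - c).val with h | h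
  · have e : b - a = (b - c) - (a - c) := by ring
    have h1 : (b - a).val = (b - c).val - (a - c).val := by rw [e, ZMod.val_sub h]
    exact (min_le_left _ _).trans (by omega)
  · have e : a - b = (a - c) - (b - c) := by ring
    have h1 : (a - b).val = (a - c).val - (b - c).val := by rw [e, ZMod.val_sub h]
    exact (min_le_right _ _).trans (by omega)

/-- the arithmetic of «α₁ sufficiently small»: with `ε = 2α₁L^{−j}`, `n ≤ (d+1)(Lʲ−1)` and `α₁ ≤ 1/4`,
`(1+ε)ⁿ ≤ e^{(d+1)/2}` and `(1+ε)ⁿ − 1 ≤ 2(d+1)e^{(d+1)/2}·α₁`. [cite: Balaban1985BackgroundPropagators, p.401 («for α₁ sufficiently small»)] -/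
theorem pow_bounds {α₁ : ℝ} (hα₁ : 0 ≤ α₁) (hα₁4 : α₁ ≤ 1 / 4) {Lj n : ℕ} (hLj : 0 < Lj) (hn : n ≤ (d + 1) * (Lj - 1)) :
    (1 + 2 * α₁ * ((Lj : ℝ))⁻¹) ^ n ≤ Real.exp (((d : ℝ) + 1) / 2) ∧
      (1 + 2 * α₁ * ((Lj : ℝ))⁻¹) ^ n - 1 ≤ 2 * ((d : ℝ) + 1) * Real.exp (((d : ℝ) + 1) / 2) * α₁ := by
  set ε : ℝ := 2 * α₁ * ((Lj : ℝ))⁻¹ with hε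
  have hLr : (0 : ℝ) < Lj := by exact_mod_cast hLj
  have hε0 : 0 ≤ ε := by positivity
  have hn' : (n : ℝ) ≤ ((d : ℝ) + 1) * (Lj : ℝ) := by
    have h1 : (n : ℝ) ≤ (((d + 1) * (Lj - 1) : ℕ) : ℝ) := by exact_mod_cast hn
    have h2 : (((d + 1) * (Lj - 1) : ℕ) : ℝ) ≤ ((d : ℝ) + 1) * (Lj : ℝ) := by
      rw [Nat.cast_mul, Nat.cast_sub hLj]; push_cast; nlinarith
    exact h1.trans h2
  have hnε : (n : ℝ) * ε ≤ 2 * ((d : ℝ) + 1) * α₁ := by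
    calc (n : ℝ) * ε ≤ (((d : ℝ) + 1) * (Lj : ℝ)) * ε := mul_le_mul_of_nonneg_right hn' hε0
      _ = 2 * ((d : ℝ) + 1) * α₁ * ((Lj : ℝ) * ((Lj : ℝ))⁻¹) := by rw [hε]; ring
      _ = 2 * ((d : ℝ) + 1) * α₁ := by rw [mul_inv_cancel₀ hLr.ne', mul_one]
  have hnε' : (n : ℝ) * ε ≤ ((d : ℝ) + 1) / 2 := by nlinarith [show (0 : ℝ) ≤ (d : ℝ) + 1 by positivity]
  have hpow : (1 + ε) ^ n ≤ Real.exp ((n : ℝ) * ε) := pow_le_exp hε0 n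
  have hE : Real.exp ((n : ℝ) * ε) ≤ Real.exp (((d : ℝ) + 1) / 2) := Real.exp_le_exp.2 hnε'
  refine ⟨hpow.trans hE, ?_⟩
  have h1 := pow_sub_one_le hε0 n
  have h2 : (n : ℝ) * ε * Real.exp ((n : ℝ) * ε) ≤ 2 * ((d : ℝ) + 1) * α₁ * Real.exp (((d : ℝ) + 1) / 2) :=
    mul_le_mul hnε hE (Real.exp_nonneg _) (by positivity)
  linarith

/-- ★★ **THE KEY ESTIMATE OF p. 401 FOR NODE 00's TAXICAB TRANSPORTER**: for a `G`-valued (unit-norm) `U`, a multiplier `e^{iηa}` with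
`η‖a_ν(v)‖ ≤ α₁·L^{−j}` at every bond based in the block `Δ(s)` (the own-level (3.37)), `α₁ ≤ 1/4`, and two torus points `x₁, x₂` within `Lʲ`
forward steps of the corner of `Δ(s)` (coordinatewise): along the taxicab contour `Γ_{x₁,x₂}`,
`‖(e^{iηa}U)(Γ) − U(Γ)‖ ≤ 2(d+1)e^{(d+1)/2}·α₁`, `‖((e^{iηa}U)(Γ))⁻¹ − (U(Γ))⁻¹‖ ≤ e^{(d+1)/2}·2(d+1)e^{(d+1)/2}·α₁`, and
`‖(e^{iηa}U)(Γ)‖, ‖((e^{iηa}U)(Γ))⁻¹‖ ≤ e^{(d+1)/2}`. [cite: Balaban1985BackgroundPropagators, p.401 («|(U′U)(Γ)(U(Γ))⁻¹ − 1| < O(1)α₁»), (3.37) p.396, (3.40) p.397] -/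
theorem norm_parTaxiV_prod_sub_le (hG1 : ∀ u : 𝔸ˣ, u ∈ G → ‖(u : 𝔸)‖ ≤ 1) {U : CfgY 𝔸 i} (hU : ∀ μ x, U μ x ∈ G)
    {η : ℝ} (hη : 0 ≤ η) (a : AfldY 𝔸 i) (s : BlkY i) {α₁ : ℝ} (hα₁ : 0 ≤ α₁) (hα₁4 : α₁ ≤ 1 / 4)
    (ha : ∀ (ν : Fin (d + 1)) (v : Site (PV d ℓ i.m i.K hd hL) 0), blkOf i.D.toDomains (toBox i.hN v) = s →
      η * ‖a ν v‖ ≤ α₁ * ((((ℓ + 1) ^ s.1.1 : ℕ) : ℝ))⁻¹)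
    (x₁ x₂ : Site (PV d ℓ i.m i.K hd hL) 0)
    (h₁ : ∀ μ, (x₁ μ - ((boxEquiv i.hN).symm (blkCornerY i s)) μ).val < (ℓ + 1) ^ s.1.1)
    (h₂ : ∀ μ, (x₂ μ - ((boxEquiv i.hN).symm (blkCornerY i s)) μ).val < (ℓ + 1) ^ s.1.1) :
    ‖((parTaxiV (mulY i (fluct η a) U) x₁ x₂ : 𝔸ˣ) : 𝔸) - (parTaxiV U x₁ x₂ : 𝔸)‖
        ≤ 2 * ((d : ℝ) + 1) * Real.exp (((d : ℝ) + 1) / 2) * α₁ ∧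
      ‖(((parTaxiV (mulY i (fluct η a) U) x₁ x₂)⁻¹ : 𝔸ˣ) : 𝔸) - (((parTaxiV U x₁ x₂)⁻¹ : 𝔸ˣ) : 𝔸)‖
        ≤ Real.exp (((d : ℝ) + 1) / 2) * (2 * ((d : ℝ) + 1) * Real.exp (((d : ℝ) + 1) / 2) * α₁) ∧
      ‖((parTaxiV (mulY i (fluct η a) U) x₁ x₂ : 𝔸ˣ) : 𝔸)‖ ≤ Real.exp (((d : ℝ) + 1) / 2) ∧
      ‖(((parTaxiV (mulY i (fluct η a) U) x₁ x₂)⁻¹ : 𝔸ˣ) : 𝔸)‖ ≤ Real.exp (((d : ℝ) + 1) / 2) := by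
  haveI : NeZero ((PV d ℓ i.m i.K hd hL).sitesPerDir 0) := inferInstance
  have hLj : 0 < (ℓ + 1) ^ s.1.1 := by positivity
  -- the transporters as signed step runs over the same steps
  set l := taxiSteps (List.finRange (d + 1)) x₁ x₂ with hl
  have hW : parTaxiV (mulY i (fluct η a) U) x₁ x₂ = stepRun (fun μ x => fluct η a μ x * U μ x) l x₁ := parTaxiV_eq_stepRun _ x₁ x₂
  have hUr : parTaxiV U x₁ x₂ = stepRun U l x₁ := parTaxiV_eq_stepRun U x₁ x₂
  have hUu : ∀ μ x, UnitaryLike (U μ x) := fun μ x => norm_le_one_and_inv_of_mem G hG1 (hU μ x)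
  -- the per-bond size of the multiplier on the rungs (all in the block)
  set ε : ℝ := 2 * α₁ * ((((ℓ + 1) ^ s.1.1 : ℕ) : ℝ))⁻¹ with hε
  have hε0 : 0 ≤ ε := by positivity
  have hx4 : α₁ * ((((ℓ + 1) ^ s.1.1 : ℕ) : ℝ))⁻¹ ≤ 1 / 4 := by
    have hL1 : (1 : ℝ) ≤ (((ℓ + 1) ^ s.1.1 : ℕ) : ℝ) := by exact_mod_cast hLj
    have : ((((ℓ + 1) ^ s.1.1 : ℕ) : ℝ))⁻¹ ≤ 1 := inv_le_one_of_one_le₀ hL1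
    nlinarith
  have hrung : ∀ r ∈ rungSites l x₁, ‖((fluct η a r.2.1 r.1 : 𝔸ˣ) : 𝔸) - 1‖ ≤ ε ∧ ‖(((fluct η a r.2.1 r.1)⁻¹ : 𝔸ˣ) : 𝔸) - 1‖ ≤ ε := by
    intro r hr
    have hblk := blkOf_toBox_rung_eq i s x₁ x₂ h₁ h₂ r hr
    have h := norm_fluct_sub_one_le i hη a r.2.1 r.1 (ha r.2.1 r.1 hblk) hx4
    rw [hε]
    exact ⟨h.1.trans (le_of_eq (by ring)), h.2.trans (le_of_eq (by ring))⟩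
  have hrungb : ∀ r ∈ rungSites l x₁, ‖((fluct η a r.2.1 r.1 : 𝔸ˣ) : 𝔸)‖ ≤ 1 + ε ∧ ‖(((fluct η a r.2.1 r.1)⁻¹ : 𝔸ˣ) : 𝔸)‖ ≤ 1 + ε := by
    intro r hr
    obtain ⟨e1, e2⟩ := hrung r hr
    exact ⟨by simpa using (norm_le_norm_add_norm_sub' ((fluct η a r.2.1 r.1 : 𝔸ˣ) : 𝔸) 1).trans (by rw [norm_one]; linarith),
      by simpa using (norm_le_norm_add_norm_sub' (((fluct η a r.2.1 r.1)⁻¹ : 𝔸ˣ) : 𝔸) 1).trans (by rw [norm_one]; linarith)⟩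
  -- the number of steps
  have hlen : l.length ≤ (d + 1) * ((ℓ + 1) ^ s.1.1 - 1) :=
    length_taxiSteps_block_le i s x₁ x₂ fun μ => min_val_sub_le (h₁ μ) (h₂ μ)
  obtain ⟨hP0, hP1⟩ := pow_bounds (d := d) hα₁ hα₁4 hLj hlen
  have hε' : (1 + 2 * α₁ * ((((ℓ + 1) ^ s.1.1 : ℕ) : ℝ))⁻¹) = 1 + ε := by rw [hε]
  rw [hε'] at hP0 hP1
  have hA := norm_stepRun_prod_sub_le hUu hε0 l x₁ hrung
  have hB := norm_inv_stepRun_prod_sub_le hUu hε0 l x₁ hrung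
  have hC := norm_stepRun_prod_le hUu hε0 l x₁ hrungb
  have hD := norm_inv_stepRun_prod_le hUu hε0 l x₁ hrungb
  rw [hW, hUr]
  refine ⟨hA.trans hP1, hB.trans ?_, hC.trans hP0, hD.trans hP0⟩
  have h0 : 0 ≤ (1 + ε) ^ l.length - 1 := by
    have := one_le_pow₀ (show (1 : ℝ) ≤ 1 + ε by linarith) (n := l.length); linarith
  exact mul_le_mul hP0 hP1 h0 (Real.exp_nonneg _)

/-- the corner's own torus point is (trivially) within `Lʲ` steps of itself. [cite: Balaban1984PropagatorsII, (2.1) p.224, bookkeeping] -/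
theorem val_sub_corner_self (s : BlkY i) (μ : Fin (d + 1)) :
    (((boxEquiv i.hN).symm (blkCornerY i s)) μ - ((boxEquiv i.hN).symm (blkCornerY i s)) μ).val < (ℓ + 1) ^ s.1.1 := by
  rw [sub_self, ZMod.val_zero]; positivity

omit [CompleteSpace 𝔸] [NormOneClass 𝔸] in
/-- the corner precedes every site of its block in the lexicographic order of the box chart (it is coordinatewise below).
[cite: Balaban1984PropagatorsII, (2.1) p.224, bookkeeping] -/
theorem toLex_corner_le (s : BlkY i) {z : SiteY i} (hz : blkOf i.D.toDomains z = s) : toLex (blkCornerY i s).1 ≤ toLex z.1 :=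
  Pi.toLex_monotone fun μ => (coord_bounds i.D.toDomains hz μ).1

/-- ★★ **(3.58) FOR NODE 00's KERNEL LETTER**: `‖kF(s, w)‖ = ‖kQ_{U′U}(s, w) − kQ_U(s, w)‖ ≤ 4(d+1)e^{3(d+1)/2}·α₁·W_s⁻¹` for `w ∈ Δ(s)` — the transporter
`parSymY`, `U` `G`-valued, the own-level (3.37) on the block, `α₁ ≤ 1/4` (clause 1 of `B9SectBGpFrameCodedY.CplxLettersY` at `par := parSymY`).
[cite: Balaban1985BackgroundPropagators, (3.58) p.402, (3.19) p.393, (3.37) p.396] -/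
theorem norm_kFY_parSymY_le (hG1 : ∀ u : 𝔸ˣ, u ∈ G → ‖(u : 𝔸)‖ ≤ 1) {U : CfgY 𝔸 i} (hU : ∀ μ x, U μ x ∈ G)
    {η : ℝ} (hη : 0 ≤ η) (a : AfldY 𝔸 i) (s : BlkY i) {α₁ : ℝ} (hα₁ : 0 ≤ α₁) (hα₁4 : α₁ ≤ 1 / 4)
    (ha : ∀ (ν : Fin (d + 1)) (v : Site (PV d ℓ i.m i.K hd hL) 0), blkOf i.D.toDomains (toBox i.hN v) = s →
      η * ‖a ν v‖ ≤ α₁ * ((((ℓ + 1) ^ s.1.1 : ℕ) : ℝ))⁻¹)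
    (w : SiteY i) (hw : blkOf i.D.toDomains w = s) :
    ‖kFY i (parSymY i) U (mulY i (fluct η a) U) s w‖ ≤ 4 * ((d : ℝ) + 1) * Real.exp (3 * (((d : ℝ) + 1) / 2)) * α₁ * (wB i s)⁻¹ := by
  have hwB : 0 < wB i s := wB_pos i s
  have hUu : ∀ μ x, UnitaryLike (U μ x) := fun μ x => norm_le_one_and_inv_of_mem G hG1 (hU μ x)
  -- the two transporters along the corner → w contour
  set p := (boxEquiv i.hN).symm (blkCornerY i s)
  set t := (boxEquiv i.hN).symm w
  have hle : toLex (blkCornerY i s).1 ≤ toLex w.1 := toLex_corner_le i s hw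
  have hW : parSymY i (mulY i (fluct η a) U) (blkCornerY i s) w = parTaxiV (mulY i (fluct η a) U) p t := parSymY_of_le hle
  have hV : parSymY i U (blkCornerY i s) w = parTaxiV U p t := parSymY_of_le hle
  obtain ⟨hA, hB, hC, hD⟩ := norm_parTaxiV_prod_sub_le i G hG1 hU hη a s hα₁ hα₁4 ha p t (val_sub_corner_self i s)
    (fun μ => (val_sub_corner i s hw μ).2)
  set q' : 𝔸ˣ := parTaxiV (mulY i (fluct η a) U) p t
  set q : 𝔸ˣ := parTaxiV U p t
  have hq : ‖(q : 𝔸)‖ ≤ 1 := by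
    rw [show q = parTaxiV U p t from rfl, parTaxiV_eq_stepRun]; exact (unitaryLike_stepRun hUu _ _).1
  set C₀ : ℝ := Real.exp (((d : ℝ) + 1) / 2) with hC₀
  have hC₀1 : 1 ≤ C₀ := Real.one_le_exp (by positivity)
  have hE3 : Real.exp (3 * (((d : ℝ) + 1) / 2)) = C₀ * C₀ * C₀ := by
    rw [hC₀, ← Real.exp_add, ← Real.exp_add]; ring_nf
  have hpos : 0 ≤ 4 * ((d : ℝ) + 1) * α₁ * (C₀ * C₀) := by positivity
  -- `kF = W_s⁻¹ · (R(q′) − R(q))`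
  have hval : kFY i (parSymY i) U (mulY i (fluct η a) U) s w = (wB i s)⁻¹ • (Rclm q' - Rclm q) := by
    simp only [kFY, kQY, hW, hV, smul_sub]
  rw [hval, norm_smul, Real.norm_eq_abs, abs_of_pos (inv_pos.2 hwB), mul_comm]
  refine mul_le_mul_of_nonneg_right ?_ (inv_nonneg.2 hwB.le)
  calc ‖Rclm q' - Rclm q‖ ≤ ‖(q' : 𝔸) - (q : 𝔸)‖ * ‖((q'⁻¹ : 𝔸ˣ) : 𝔸)‖ + ‖(q : 𝔸)‖ * ‖((q'⁻¹ : 𝔸ˣ) : 𝔸) - ((q⁻¹ : 𝔸ˣ) : 𝔸)‖ :=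
        norm_Rclm_sub_le q' q
    _ ≤ (2 * ((d : ℝ) + 1) * C₀ * α₁) * C₀ + 1 * (C₀ * (2 * ((d : ℝ) + 1) * C₀ * α₁)) := by
        gcongr
    _ = (4 * ((d : ℝ) + 1) * α₁ * (C₀ * C₀)) * 1 := by ring
    _ ≤ (4 * ((d : ℝ) + 1) * α₁ * (C₀ * C₀)) * C₀ := mul_le_mul_of_nonneg_left hC₀1 hpos
    _ = 4 * ((d : ℝ) + 1) * Real.exp (3 * (((d : ℝ) + 1) / 2)) * α₁ := by rw [hE3]; ring

/-- ★★ **(3.59)-SHAPE FOR NODE 00's STARRED LETTER**: `‖sF(z)‖ = ‖sQ_{U′U}(z) − sQ_U(z)‖ ≤ 4(d+1)e^{3(d+1)/2}·α₁` — the transporter `parSymY` from `z` to the corner of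
its block (either branch of the symmetrisation), `U` `G`-valued, the own-level (3.37) on the block of `z`, `α₁ ≤ 1/4` (clause 2 of `CplxLettersY` at
`par := parSymY`). [cite: Balaban1985BackgroundPropagators, (3.59) p.402, (3.24) p.394, (3.37) p.396] -/
theorem norm_sFY_parSymY_le (hG1 : ∀ u : 𝔸ˣ, u ∈ G → ‖(u : 𝔸)‖ ≤ 1) {U : CfgY 𝔸 i} (hU : ∀ μ x, U μ x ∈ G)
    {η : ℝ} (hη : 0 ≤ η) (a : AfldY 𝔸 i) (z : SiteY i) {α₁ : ℝ} (hα₁ : 0 ≤ α₁) (hα₁4 : α₁ ≤ 1 / 4)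
    (ha : ∀ (ν : Fin (d + 1)) (v : Site (PV d ℓ i.m i.K hd hL) 0), blkOf i.D.toDomains (toBox i.hN v) = blkOf i.D.toDomains z →
      η * ‖a ν v‖ ≤ α₁ * ((((ℓ + 1) ^ (blkOf i.D.toDomains z).1.1 : ℕ) : ℝ))⁻¹) :
    ‖sFY i (parSymY i) U (mulY i (fluct η a) U) z‖ ≤ 4 * ((d : ℝ) + 1) * Real.exp (3 * (((d : ℝ) + 1) / 2)) * α₁ := by
  set s := blkOf i.D.toDomains z with hs
  set p := (boxEquiv i.hN).symm (blkCornerY i s)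
  set t := (boxEquiv i.hN).symm z
  have hUu : ∀ μ x, UnitaryLike (U μ x) := fun μ x => norm_le_one_and_inv_of_mem G hG1 (hU μ x)
  have hcz : blkCornerY i (blkY i z) = blkCornerY i s := by rw [blkY_apply]
  set C₀ : ℝ := Real.exp (((d : ℝ) + 1) / 2) with hC₀
  have hC₀1 : 1 ≤ C₀ := Real.one_le_exp (by positivity)
  have hC₀0 : 0 ≤ C₀ := zero_le_one.trans hC₀1
  have hE3 : Real.exp (3 * (((d : ℝ) + 1) / 2)) = C₀ * C₀ * C₀ := by
    rw [hC₀, ← Real.exp_add, ← Real.exp_add]; ring_nf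
  have hpos : 0 ≤ 2 * ((d : ℝ) + 1) * α₁ * C₀ := by positivity
  have hsq : 1 ≤ C₀ * C₀ := one_le_mul_of_one_le_of_one_le hC₀1 hC₀1
  by_cases hle : toLex z.1 ≤ toLex (blkCornerY i s).1
  · -- the contour from `z` to the corner
    have hW : parSymY i (mulY i (fluct η a) U) z (blkCornerY i (blkY i z)) = parTaxiV (mulY i (fluct η a) U) t p := by
      rw [hcz]; exact parSymY_of_le hle
    have hV : parSymY i U z (blkCornerY i (blkY i z)) = parTaxiV U t p := by rw [hcz]; exact parSymY_of_le hle
    obtain ⟨hA, hB, hC, hD⟩ := norm_parTaxiV_prod_sub_le i G hG1 hU hη a s hα₁ hα₁4 ha t p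
      (fun μ => (val_sub_corner i s rfl μ).2) (val_sub_corner_self i s)
    set q' : 𝔸ˣ := parTaxiV (mulY i (fluct η a) U) t p
    set q : 𝔸ˣ := parTaxiV U t p
    have hq : ‖(q : 𝔸)‖ ≤ 1 := by
      rw [show q = parTaxiV U t p from rfl, parTaxiV_eq_stepRun]; exact (unitaryLike_stepRun hUu _ _).1
    have hval : sFY i (parSymY i) U (mulY i (fluct η a) U) z = Rclm q' - Rclm q := by
      simp only [sFY, sQY, hW, hV]
    rw [hval]
    calc ‖Rclm q' - Rclm q‖ ≤ ‖(q' : 𝔸) - (q : 𝔸)‖ * ‖((q'⁻¹ : 𝔸ˣ) : 𝔸)‖ + ‖(q : 𝔸)‖ * ‖((q'⁻¹ : 𝔸ˣ) : 𝔸) - ((q⁻¹ : 𝔸ˣ) : 𝔸)‖ :=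
          norm_Rclm_sub_le q' q
      _ ≤ (2 * ((d : ℝ) + 1) * C₀ * α₁) * C₀ + 1 * (C₀ * (2 * ((d : ℝ) + 1) * C₀ * α₁)) := by gcongr
      _ = (2 * ((d : ℝ) + 1) * α₁ * C₀) * (C₀ + C₀) := by ring
      _ ≤ (2 * ((d : ℝ) + 1) * α₁ * C₀) * (C₀ * C₀ + C₀ * C₀) :=
          mul_le_mul_of_nonneg_left (by nlinarith) hpos
      _ = 4 * ((d : ℝ) + 1) * Real.exp (3 * (((d : ℝ) + 1) / 2)) * α₁ := by rw [hE3]; ring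
  · -- the inverse of the contour from the corner to `z`
    have hW : parSymY i (mulY i (fluct η a) U) z (blkCornerY i (blkY i z)) = (parTaxiV (mulY i (fluct η a) U) p t)⁻¹ := by
      rw [hcz]; exact parSymY_of_not_le hle
    have hV : parSymY i U z (blkCornerY i (blkY i z)) = (parTaxiV U p t)⁻¹ := by rw [hcz]; exact parSymY_of_not_le hle
    obtain ⟨hA, hB, hC, hD⟩ := norm_parTaxiV_prod_sub_le i G hG1 hU hη a s hα₁ hα₁4 ha p t (val_sub_corner_self i s)
      (fun μ => (val_sub_corner i s rfl μ).2)
    set q' : 𝔸ˣ := parTaxiV (mulY i (fluct η a) U) p t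
    set q : 𝔸ˣ := parTaxiV U p t
    have hq : ‖((q⁻¹ : 𝔸ˣ) : 𝔸)‖ ≤ 1 := by
      rw [show q = parTaxiV U p t from rfl, parTaxiV_eq_stepRun]; exact (unitaryLike_stepRun hUu _ _).2
    have hval : sFY i (parSymY i) U (mulY i (fluct η a) U) z = Rclm q'⁻¹ - Rclm q⁻¹ := by
      simp only [sFY, sQY, hW, hV]
    rw [hval]
    calc ‖Rclm q'⁻¹ - Rclm q⁻¹‖
        ≤ ‖((q'⁻¹ : 𝔸ˣ) : 𝔸) - ((q⁻¹ : 𝔸ˣ) : 𝔸)‖ * ‖((q'⁻¹⁻¹ : 𝔸ˣ) : 𝔸)‖ + ‖((q⁻¹ : 𝔸ˣ) : 𝔸)‖ * ‖((q'⁻¹⁻¹ : 𝔸ˣ) : 𝔸) - ((q⁻¹⁻¹ : 𝔸ˣ) : 𝔸)‖ :=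
          norm_Rclm_sub_le q'⁻¹ q⁻¹
      _ = ‖((q'⁻¹ : 𝔸ˣ) : 𝔸) - ((q⁻¹ : 𝔸ˣ) : 𝔸)‖ * ‖(q' : 𝔸)‖ + ‖((q⁻¹ : 𝔸ˣ) : 𝔸)‖ * ‖(q' : 𝔸) - (q : 𝔸)‖ := by rw [inv_inv, inv_inv]
      _ ≤ (C₀ * (2 * ((d : ℝ) + 1) * C₀ * α₁)) * C₀ + 1 * (2 * ((d : ℝ) + 1) * C₀ * α₁) := by gcongr
      _ = (2 * ((d : ℝ) + 1) * α₁ * C₀) * (C₀ * C₀ + 1) := by ring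
      _ ≤ (2 * ((d : ℝ) + 1) * α₁ * C₀) * (C₀ * C₀ + C₀ * C₀) :=
          mul_le_mul_of_nonneg_left (by linarith) hpos
      _ = 4 * ((d : ℝ) + 1) * Real.exp (3 * (((d : ℝ) + 1) / 2)) * α₁ := by rw [hE3]; ring

end Estimate

end Literature.MathematicalPhysics.QuantumFieldTheory.Balaban1983to89.B9Eq358TaxiLettersY
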